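import Summits.Parity.GeneralizedHardyLittlewood.Theorems.GreenTaoLevelTwoMNTwoBracketFrameHeis
import Summits.Parity.GeneralizedHardyLittlewood.Theorems.GreenTaoLevelTwoMNTwoCentralFrames

/-!
# Route `GreenTaoLevelTwo`, crux `MNTwo` (stmt-Parity-21276), line `birth`, stub `stub_mnVertical`:
# GT 2008b App. A (Prop. 5) — bracket frames of the circle, the point, `ofLE`; transport

Block V7 of the `stub_mnVertical` census (B. Green, T. Tao, *Quadratic uniformity of the Möbius
function*, Ann. Inst. Fourier 58 (2008) = arXiv:math/0606087, App. A, Prop. 5, "completely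
explicit when the group `G` is a product of Heisenberg groups").  The def-free BRACKET FRAME
proposition of `…MNTwoBracketFrameHeis` (horizontal torus coordinates `π`, Lipschitz periodic
partition of unity `χ`, `Γ`-periodic Lipschitz sections `σ`, central parts `ζ` trivial on `3`-cubes
inside the supports) is carried by the circle (`I = P = Unit`, `σ(u) = u`, `ζ = 1`: a `1`-step
nilsequence needs no bracket) and the point, is inherited by `ofLE`, and is transported along any
group isomorphism `Y.G ≃* H` matching the lattice and the metric (`bracketFrame_transport`, used for
products in the sequel file and for the Heisenberg generator).

References: [GreenTao2008QuadraticMobius] arXiv:math/0606087, App. A, Prop. 5.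
-/

noncomputable section

open Literature.NumberTheory.Sieve
open Literature.NumberTheory.Sieve.GreenTaoLevelTwo (HX IsCompatMetric IsBoxComparable heisenbergWith
  InHeisClass boxGauge heisPreDist)
open Summit.Parity.GeneralizedHardyLittlewood.GreenTaoLevelTwoMNTwoCentralTranslation
open Summit.Parity.GeneralizedHardyLittlewood.GreenTaoLevelTwoMNTwoCentralFrames (quotientProdMap_smul)

namespace Summit.Parity.GeneralizedHardyLittlewood.GreenTaoLevelTwoMNTwoBracketFrameBasic

/-! ### §1 The circle and the point -/

/-- **The circle `ℝ/ℤ` carries a bracket frame** (one torus direction, one piece, identity section,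
trivial central parts). [cite: GreenTao2008QuadraticMobius, App. A, Prop. 5 (1-step case: nothing to do)] -/
theorem bracketFrame_circle :
    ∃ (I : Type) (_ : Fintype I) (P : Type) (_ : Fintype P)
        (π : (Nilmanifold.circle).G → (I → ℝ)) (χ : P → (I → ℝ) → ℝ) (σ : P → (I → ℝ) → (Nilmanifold.circle).G)
        (ζ : P → (Nilmanifold.circle).G → (Nilmanifold.circle).G) (K : ℝ), 0 ≤ K ∧
        (∀ g g' : (Nilmanifold.circle).G, π (g * g') = π g + π g') ∧
        (∀ p u, 0 ≤ χ p u) ∧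
        (∀ u, ∑ p, χ p u = 1) ∧
        (∀ p u (v : I → ℤ), χ p (u + fun i => (v i : ℝ)) = χ p u) ∧
        (∀ p u u', |χ p u - χ p u'| ≤ K * dist u u') ∧
        (∀ p u (v : I → ℤ), ∃ γ ∈ (Nilmanifold.circle).Γ, σ p (u + fun i => (v i : ℝ)) = σ p u * γ) ∧
        (∀ p u u', dist u u' ≤ 1 →
          (Nilmanifold.circle).dist (σ p u : (Nilmanifold.circle).G ⧸ (Nilmanifold.circle).Γ) (σ p u' : (Nilmanifold.circle).G ⧸ (Nilmanifold.circle).Γ) ≤ K * dist u u') ∧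
        (∀ p w, ζ p w ∈ Subgroup.center (Nilmanifold.circle).G) ∧
        (∀ p w, χ p (π w) ≠ 0 → ∃ γ ∈ (Nilmanifold.circle).Γ, w = ζ p w * σ p (π w) * γ) ∧
        (∀ p (g x₀ : (Nilmanifold.circle).G) (n h₁ h₂ h₃ : ℤ),
          (∀ e₁ e₂ e₃ : ℕ, e₁ ≤ 1 → e₂ ≤ 1 → e₃ ≤ 1 →
            χ p (π (g ^ (n + e₁ * h₁ + e₂ * h₂ + e₃ * h₃) * x₀)) ≠ 0) →
          ζ p (g ^ (n + h₁ + h₂ + h₃) * x₀) * (ζ p (g ^ (n + h₁ + h₂) * x₀))⁻¹ *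
            (ζ p (g ^ (n + h₁ + h₃) * x₀))⁻¹ * (ζ p (g ^ (n + h₂ + h₃) * x₀))⁻¹ *
            ζ p (g ^ (n + h₁) * x₀) * ζ p (g ^ (n + h₂) * x₀) * ζ p (g ^ (n + h₃) * x₀) *
            (ζ p (g ^ n * x₀))⁻¹ = 1) := by
  refine ⟨Unit, inferInstance, Unit, inferInstance,
    fun g _ => Multiplicative.toAdd (g : Multiplicative ℝ), fun _ _ => 1,
    fun _ u => Nilmanifold.circleElt (u ()), fun _ _ => 1, 1, zero_le_one,
    fun g g' => ?_, fun _ _ => zero_le_one, fun u => by simp, fun _ _ _ => rfl, fun _ u u' => ?_,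
    fun _ u v => ?_, fun _ u u' _ => ?_, fun _ _ => Subgroup.one_mem _, fun _ w _ => ?_,
    fun _ g x₀ n h₁ h₂ h₃ _ => by simp⟩
  · funext i
    rfl
  · simp only [sub_self, abs_zero, one_mul]; exact dist_nonneg
  · refine ⟨Nilmanifold.circleElt ((v () : ℤ) : ℝ), circleElt_intCast_mem_Γ (v ()), ?_⟩
    simp only [Pi.add_apply]
    exact (Nilmanifold.circleElt_mul _ _).symm
  · show Dist.dist ((u () : ℝ) : AddCircle (1 : ℝ)) ((u' () : ℝ) : AddCircle (1 : ℝ)) ≤ 1 * dist u u'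
    rw [dist_eq_norm, ← AddCircle.coe_sub, one_mul]
    refine (GreenTaoLevelTwoMNTwoRotationBohrSize.norm_coe_le_abs' _).trans ?_
    rw [← Real.dist_eq]
    exact dist_le_pi_dist u u' ()
  · exact ⟨1, Subgroup.one_mem _, by simp; rfl⟩

/-- **The point carries a bracket frame** (no torus direction, one piece). [folklore] -/
theorem bracketFrame_point (s : ℕ) :
    ∃ (I : Type) (_ : Fintype I) (P : Type) (_ : Fintype P)
        (π : (Nilmanifold.point s).G → (I → ℝ)) (χ : P → (I → ℝ) → ℝ) (σ : P → (I → ℝ) → (Nilmanifold.point s).G)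
        (ζ : P → (Nilmanifold.point s).G → (Nilmanifold.point s).G) (K : ℝ), 0 ≤ K ∧
        (∀ g g' : (Nilmanifold.point s).G, π (g * g') = π g + π g') ∧
        (∀ p u, 0 ≤ χ p u) ∧
        (∀ u, ∑ p, χ p u = 1) ∧
        (∀ p u (v : I → ℤ), χ p (u + fun i => (v i : ℝ)) = χ p u) ∧
        (∀ p u u', |χ p u - χ p u'| ≤ K * dist u u') ∧
        (∀ p u (v : I → ℤ), ∃ γ ∈ (Nilmanifold.point s).Γ, σ p (u + fun i => (v i : ℝ)) = σ p u * γ) ∧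
        (∀ p u u', dist u u' ≤ 1 →
          (Nilmanifold.point s).dist (σ p u : (Nilmanifold.point s).G ⧸ (Nilmanifold.point s).Γ) (σ p u' : (Nilmanifold.point s).G ⧸ (Nilmanifold.point s).Γ) ≤ K * dist u u') ∧
        (∀ p w, ζ p w ∈ Subgroup.center (Nilmanifold.point s).G) ∧
        (∀ p w, χ p (π w) ≠ 0 → ∃ γ ∈ (Nilmanifold.point s).Γ, w = ζ p w * σ p (π w) * γ) ∧
        (∀ p (g x₀ : (Nilmanifold.point s).G) (n h₁ h₂ h₃ : ℤ),
          (∀ e₁ e₂ e₃ : ℕ, e₁ ≤ 1 → e₂ ≤ 1 → e₃ ≤ 1 →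
            χ p (π (g ^ (n + e₁ * h₁ + e₂ * h₂ + e₃ * h₃) * x₀)) ≠ 0) →
          ζ p (g ^ (n + h₁ + h₂ + h₃) * x₀) * (ζ p (g ^ (n + h₁ + h₂) * x₀))⁻¹ *
            (ζ p (g ^ (n + h₁ + h₃) * x₀))⁻¹ * (ζ p (g ^ (n + h₂ + h₃) * x₀))⁻¹ *
            ζ p (g ^ (n + h₁) * x₀) * ζ p (g ^ (n + h₂) * x₀) * ζ p (g ^ (n + h₃) * x₀) *
            (ζ p (g ^ n * x₀))⁻¹ = 1) := by
  refine ⟨Fin 0, inferInstance, Unit, inferInstance, fun _ _ => 0, fun _ _ => 1, fun _ _ => 1,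
    fun _ _ => 1, 0, le_rfl, fun g g' => ?_, fun _ _ => zero_le_one, fun u => by simp,
    fun _ _ _ => rfl, fun _ u u' => by simp, fun _ u v => ⟨1, Subgroup.one_mem _, by simp⟩,
    fun _ u u' _ => ?_, fun _ _ => Subgroup.one_mem _, fun _ w _ => ⟨w, Subgroup.mem_top _, by simp⟩,
    fun _ g x₀ n h₁ h₂ h₃ _ => by simp⟩
  · funext i; simp
  · show (0 : ℝ) ≤ 0 * dist u u'
    simp

/-! ### §2 `ofLE` -/

/-- Raising the step does not change bracket frames (same group, lattice and metric). [folklore] -/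
theorem bracketFrame_ofLE {s s' : ℕ} (X : Nilmanifold s) (hs : s ≤ s')
    (hX : ∃ (I : Type) (_ : Fintype I) (P : Type) (_ : Fintype P)
        (π : (X).G → (I → ℝ)) (χ : P → (I → ℝ) → ℝ) (σ : P → (I → ℝ) → (X).G)
        (ζ : P → (X).G → (X).G) (K : ℝ), 0 ≤ K ∧
        (∀ g g' : (X).G, π (g * g') = π g + π g') ∧
        (∀ p u, 0 ≤ χ p u) ∧
        (∀ u, ∑ p, χ p u = 1) ∧
        (∀ p u (v : I → ℤ), χ p (u + fun i => (v i : ℝ)) = χ p u) ∧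
        (∀ p u u', |χ p u - χ p u'| ≤ K * dist u u') ∧
        (∀ p u (v : I → ℤ), ∃ γ ∈ (X).Γ, σ p (u + fun i => (v i : ℝ)) = σ p u * γ) ∧
        (∀ p u u', dist u u' ≤ 1 →
          (X).dist (σ p u : (X).G ⧸ (X).Γ) (σ p u' : (X).G ⧸ (X).Γ) ≤ K * dist u u') ∧
        (∀ p w, ζ p w ∈ Subgroup.center (X).G) ∧
        (∀ p w, χ p (π w) ≠ 0 → ∃ γ ∈ (X).Γ, w = ζ p w * σ p (π w) * γ) ∧
        (∀ p (g x₀ : (X).G) (n h₁ h₂ h₃ : ℤ),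
          (∀ e₁ e₂ e₃ : ℕ, e₁ ≤ 1 → e₂ ≤ 1 → e₃ ≤ 1 →
            χ p (π (g ^ (n + e₁ * h₁ + e₂ * h₂ + e₃ * h₃) * x₀)) ≠ 0) →
          ζ p (g ^ (n + h₁ + h₂ + h₃) * x₀) * (ζ p (g ^ (n + h₁ + h₂) * x₀))⁻¹ *
            (ζ p (g ^ (n + h₁ + h₃) * x₀))⁻¹ * (ζ p (g ^ (n + h₂ + h₃) * x₀))⁻¹ *
            ζ p (g ^ (n + h₁) * x₀) * ζ p (g ^ (n + h₂) * x₀) * ζ p (g ^ (n + h₃) * x₀) *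
            (ζ p (g ^ n * x₀))⁻¹ = 1)) :
    ∃ (I : Type) (_ : Fintype I) (P : Type) (_ : Fintype P)
        (π : (X.ofLE hs).G → (I → ℝ)) (χ : P → (I → ℝ) → ℝ) (σ : P → (I → ℝ) → (X.ofLE hs).G)
        (ζ : P → (X.ofLE hs).G → (X.ofLE hs).G) (K : ℝ), 0 ≤ K ∧
        (∀ g g' : (X.ofLE hs).G, π (g * g') = π g + π g') ∧
        (∀ p u, 0 ≤ χ p u) ∧
        (∀ u, ∑ p, χ p u = 1) ∧
        (∀ p u (v : I → ℤ), χ p (u + fun i => (v i : ℝ)) = χ p u) ∧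
        (∀ p u u', |χ p u - χ p u'| ≤ K * dist u u') ∧
        (∀ p u (v : I → ℤ), ∃ γ ∈ (X.ofLE hs).Γ, σ p (u + fun i => (v i : ℝ)) = σ p u * γ) ∧
        (∀ p u u', dist u u' ≤ 1 →
          (X.ofLE hs).dist (σ p u : (X.ofLE hs).G ⧸ (X.ofLE hs).Γ) (σ p u' : (X.ofLE hs).G ⧸ (X.ofLE hs).Γ) ≤ K * dist u u') ∧
        (∀ p w, ζ p w ∈ Subgroup.center (X.ofLE hs).G) ∧
        (∀ p w, χ p (π w) ≠ 0 → ∃ γ ∈ (X.ofLE hs).Γ, w = ζ p w * σ p (π w) * γ) ∧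
        (∀ p (g x₀ : (X.ofLE hs).G) (n h₁ h₂ h₃ : ℤ),
          (∀ e₁ e₂ e₃ : ℕ, e₁ ≤ 1 → e₂ ≤ 1 → e₃ ≤ 1 →
            χ p (π (g ^ (n + e₁ * h₁ + e₂ * h₂ + e₃ * h₃) * x₀)) ≠ 0) →
          ζ p (g ^ (n + h₁ + h₂ + h₃) * x₀) * (ζ p (g ^ (n + h₁ + h₂) * x₀))⁻¹ *
            (ζ p (g ^ (n + h₁ + h₃) * x₀))⁻¹ * (ζ p (g ^ (n + h₂ + h₃) * x₀))⁻¹ *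
            ζ p (g ^ (n + h₁) * x₀) * ζ p (g ^ (n + h₂) * x₀) * ζ p (g ^ (n + h₃) * x₀) *
            (ζ p (g ^ n * x₀))⁻¹ = 1) :=
  hX

/-! ### §3 Transport along group isomorphisms -/

/-- **Transport of bracket frames along a group isomorphism**: if the group of a nilmanifold `Y`
is identified by `e : Y.G ≃* H` with a group `H` carrying a subgroup `Λ = e(Γ)` and a distance
`d_H` on `H/Λ` matching `d_Y`, a bracket frame in the coordinates `(H, Λ, d_H)` is a bracket frame of
`Y` (pull back `π`, push sections and central parts through `e⁻¹`). [folklore] -/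
theorem bracketFrame_transport {s : ℕ} (Y : Nilmanifold s) {H : Type} [Group H] (Λ : Subgroup H)
    (dH : H ⧸ Λ → H ⧸ Λ → ℝ) (e : Y.G ≃* H) (hΓ : ∀ γ : Y.G, γ ∈ Y.Γ ↔ e γ ∈ Λ)
    (hdist : ∀ x y : Y.G, Y.dist (x : Y.G ⧸ Y.Γ) (y : Y.G ⧸ Y.Γ) = dH (e x : H ⧸ Λ) (e y : H ⧸ Λ))
    (hH : ∃ (I : Type) (_ : Fintype I) (P : Type) (_ : Fintype P)
        (π : H → (I → ℝ)) (χ : P → (I → ℝ) → ℝ) (σ : P → (I → ℝ) → H)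
        (ζ : P → H → H) (K : ℝ), 0 ≤ K ∧
        (∀ g g' : H, π (g * g') = π g + π g') ∧
        (∀ p u, 0 ≤ χ p u) ∧
        (∀ u, ∑ p, χ p u = 1) ∧
        (∀ p u (v : I → ℤ), χ p (u + fun i => (v i : ℝ)) = χ p u) ∧
        (∀ p u u', |χ p u - χ p u'| ≤ K * dist u u') ∧
        (∀ p u (v : I → ℤ), ∃ γ ∈ Λ, σ p (u + fun i => (v i : ℝ)) = σ p u * γ) ∧
        (∀ p u u', dist u u' ≤ 1 →
          dH (σ p u : H ⧸ Λ) (σ p u' : H ⧸ Λ) ≤ K * dist u u') ∧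
        (∀ p w, ζ p w ∈ Subgroup.center H) ∧
        (∀ p w, χ p (π w) ≠ 0 → ∃ γ ∈ Λ, w = ζ p w * σ p (π w) * γ) ∧
        (∀ p (g x₀ : H) (n h₁ h₂ h₃ : ℤ),
          (∀ e₁ e₂ e₃ : ℕ, e₁ ≤ 1 → e₂ ≤ 1 → e₃ ≤ 1 →
            χ p (π (g ^ (n + e₁ * h₁ + e₂ * h₂ + e₃ * h₃) * x₀)) ≠ 0) →
          ζ p (g ^ (n + h₁ + h₂ + h₃) * x₀) * (ζ p (g ^ (n + h₁ + h₂) * x₀))⁻¹ *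
            (ζ p (g ^ (n + h₁ + h₃) * x₀))⁻¹ * (ζ p (g ^ (n + h₂ + h₃) * x₀))⁻¹ *
            ζ p (g ^ (n + h₁) * x₀) * ζ p (g ^ (n + h₂) * x₀) * ζ p (g ^ (n + h₃) * x₀) *
            (ζ p (g ^ n * x₀))⁻¹ = 1)) :
    ∃ (I : Type) (_ : Fintype I) (P : Type) (_ : Fintype P)
        (π : (Y).G → (I → ℝ)) (χ : P → (I → ℝ) → ℝ) (σ : P → (I → ℝ) → (Y).G)
        (ζ : P → (Y).G → (Y).G) (K : ℝ), 0 ≤ K ∧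
        (∀ g g' : (Y).G, π (g * g') = π g + π g') ∧
        (∀ p u, 0 ≤ χ p u) ∧
        (∀ u, ∑ p, χ p u = 1) ∧
        (∀ p u (v : I → ℤ), χ p (u + fun i => (v i : ℝ)) = χ p u) ∧
        (∀ p u u', |χ p u - χ p u'| ≤ K * dist u u') ∧
        (∀ p u (v : I → ℤ), ∃ γ ∈ (Y).Γ, σ p (u + fun i => (v i : ℝ)) = σ p u * γ) ∧
        (∀ p u u', dist u u' ≤ 1 →
          (Y).dist (σ p u : (Y).G ⧸ (Y).Γ) (σ p u' : (Y).G ⧸ (Y).Γ) ≤ K * dist u u') ∧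
        (∀ p w, ζ p w ∈ Subgroup.center (Y).G) ∧
        (∀ p w, χ p (π w) ≠ 0 → ∃ γ ∈ (Y).Γ, w = ζ p w * σ p (π w) * γ) ∧
        (∀ p (g x₀ : (Y).G) (n h₁ h₂ h₃ : ℤ),
          (∀ e₁ e₂ e₃ : ℕ, e₁ ≤ 1 → e₂ ≤ 1 → e₃ ≤ 1 →
            χ p (π (g ^ (n + e₁ * h₁ + e₂ * h₂ + e₃ * h₃) * x₀)) ≠ 0) →
          ζ p (g ^ (n + h₁ + h₂ + h₃) * x₀) * (ζ p (g ^ (n + h₁ + h₂) * x₀))⁻¹ *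
            (ζ p (g ^ (n + h₁ + h₃) * x₀))⁻¹ * (ζ p (g ^ (n + h₂ + h₃) * x₀))⁻¹ *
            ζ p (g ^ (n + h₁) * x₀) * ζ p (g ^ (n + h₂) * x₀) * ζ p (g ^ (n + h₃) * x₀) *
            (ζ p (g ^ n * x₀))⁻¹ = 1) := by
  obtain ⟨I, iI, P, iP, π, χ, σ, ζ, K, hK, hπ, hχ0, hχ1, hχper, hχlip, hσper, hσlip, hζ, hbr, hcube⟩ :=
    hH
  refine ⟨I, iI, P, iP, fun w => π (e w), χ, fun p u => e.symm (σ p u),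
    fun p w => e.symm (ζ p (e w)), K, hK, fun g g' => ?_, hχ0, hχ1, hχper, hχlip, fun p u v => ?_,
    fun p u u' huu' => ?_, fun p w => ?_, fun p w hw => ?_, fun p g x₀ n h₁ h₂ h₃ hsupp => ?_⟩
  · show π (e (g * g')) = π (e g) + π (e g')
    rw [map_mul]; exact hπ _ _
  · obtain ⟨γ, hγ, hσ⟩ := hσper p u v
    refine ⟨e.symm γ, (hΓ _).mpr (by simpa using hγ), ?_⟩
    show e.symm (σ p (u + fun i => (v i : ℝ))) = e.symm (σ p u) * e.symm γ
    rw [hσ, map_mul]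
  · show Y.dist (e.symm (σ p u) : Y.G ⧸ Y.Γ) (e.symm (σ p u') : Y.G ⧸ Y.Γ) ≤ K * dist u u'
    rw [hdist, MulEquiv.apply_symm_apply, MulEquiv.apply_symm_apply]
    exact hσlip p u u' huu'
  · rw [Subgroup.mem_center_iff]
    intro g
    apply e.injective
    rw [map_mul, map_mul, MulEquiv.apply_symm_apply]
    exact Subgroup.mem_center_iff.mp (hζ p (e w)) (e g)
  · obtain ⟨γ, hγ, hwd⟩ := hbr p (e w) hw
    refine ⟨e.symm γ, (hΓ _).mpr (by simpa using hγ), ?_⟩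
    have key := congrArg e.symm hwd
    simp only [map_mul, MulEquiv.symm_apply_apply] at key
    beta_reduce
    exact key
  · have hsupp' : ∀ e₁ e₂ e₃ : ℕ, e₁ ≤ 1 → e₂ ≤ 1 → e₃ ≤ 1 →
        χ p (π ((e g) ^ (n + e₁ * h₁ + e₂ * h₂ + e₃ * h₃) * e x₀)) ≠ 0 := by
      intro e₁ e₂ e₃ a b c
      have h' := hsupp e₁ e₂ e₃ a b c
      beta_reduce at h'
      rwa [map_mul, map_zpow] at h'
    have key := congrArg e.symm (hcube p (e g) (e x₀) n h₁ h₂ h₃ hsupp')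
    simp only [map_mul, map_inv, map_one] at key
    beta_reduce
    simp only [map_mul, map_zpow]
    exact key

end Summit.Parity.GeneralizedHardyLittlewood.GreenTaoLevelTwoMNTwoBracketFrameBasic
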